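import Summits.ValiantsHypothesis.ValiantsHypothesis.Theorems.KPlusLogSqLawTridiagonalRealStaticFiveEdgeMonotone
import Summits.ValiantsHypothesis.ValiantsHypothesis.Theorems.KPlusLogSqLawTridiagonalRealStaticWronskian

/-!
# Route «KPlusLogSqLaw», crux `WeakLifting` (stmt-ValiantsHypothesis-19561) — REAL side of the tridiagonal sector:
# the MONOTONE-PIECE LAW for `5 × 5` designs — at most ONE positive determinant zero on an interval where both Schur summands are monotone

HONEST FRAMING.  Helper theorems (`--supports stmt-ValiantsHypothesis-19561 --as helper`), seat val-sym-lift-p3 (g11), cell `pub-symmetroid`,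
2026-08-28; Part 4 of the `m = 5` arena (Parts 1–3: `…TridiagonalRealStaticOverlap` p590486, `…FiveGeography` p594929, `…FiveEdgeMonotone`
p596008).  A LOCAL COUNT TOOL for ALL definite irreducible `5 × 5` designs, not an upper law: `B 5 ∈ [5, 7]` (kernel) is unchanged and the
located `B 5 = 5` is not claimed.  THE MECHANISM (memo HOME/val-sym-lift-p3/g11/memo-liftp3g11.md §4): off the poles the positive zeros of
`D₅` are the solutions of the Schur form `φ + ψ = 1`, `φ = b₁²a₀x^{2f₁+d₀}/(a₂x^{d₂}D₂)`, `ψ = b₂²a₄x^{2f₂+d₄}/(a₂x^{d₂}Δ)` (`Δ` the trailing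
`2 × 2` minor); the sign of `φ′` is the sign of `N_L(x) = σ₂·a₁a₀x^{d₁+d₀} + (σ₁−σ₂)·b₀²x^{2f₀}` (`σ₁ = 2f₀−d₀−d₁`, `σ₂ = 2f₁−d₁−d₂`), a two-term
function with AT MOST ONE sign change on `(0, ∞)`, and likewise `sign ψ′ = sign N_R`, `N_R(x) = σ₃·a₄a₃x^{d₄+d₃} + (σ₄−σ₃)·b₃²x^{2f₃}`.  Hence
on an interval free of poles on which `N_L` and `N_R` are both positive (or both negative) the Schur form is strictly monotone and `D₅` has AT
MOST ONE zero there («good pieces»; the located bulk of the zeros sits on the «bad» pieces where `N_L N_R < 0`, up to `3` per piece in the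
census — NOT bounded here).  Part 3 is the special case in which the good-piece structure is global.  Nothing here bears on `WeakLifting` /
`TropicalB` (stmt-19771) in their windows, on Conjecture B, on the Door-A registers, on `MatrixDescartes` (stmt-ValiantsHypothesis-18050) or on
VP ≠ VNP; α status NO MOVER.

WHAT IS PROVED (continuant currency `D_k = pathDet a d b f k`; `x^{d₂}N_L` and `x^{d₂}N_R` are written out as the explicit two-term functions
`NL`, `NR` in the statements, with the rates as real differences of the natural exponents).
* `eval_schurDen_left/right` — `a₂x^{d₂}·D₂(x)` and `a₂x^{d₂}·Δ(x)` as explicit two-term polynomials `Q_L`, `Q_R` evaluated.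
* `hasDerivAt_schur_left/right` — the derivative of `φ = P_L/Q_L` (resp. `ψ`) at a point where the denominator is nonzero, with the EULER
  IDENTITY `x·(P′Q − PQ′)(x) = P(x)·a₂·NL(x)` for the numerator (`X_mul_derivative_monomial` of val-sym-lift-p2 g11).
* **`five_monotone_piece`** — for a definite irreducible design and `0 < x < y` two zeros of `D₅` such that on `[x, y]` the end minors `D₂`, `Δ`
  do not vanish and `NL > 0`, `NR > 0`: contradiction (the Schur form is strictly increasing on `[x, y]` and equals `1` at both ends);
  **`five_antitone_piece`** — the same with `NL < 0`, `NR < 0`.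
[this seat's `m = 5` analysis; folklore: quotient rule, monotonicity from the sign of the derivative]
-/

-- `Summit.ValiantsHypothesis.ValiantsHypothesis.…` repeats a component by the D-0017 layout (single-conjunct summit); the name is mandated.
set_option linter.dupNamespace false
set_option autoImplicit false

namespace Summit.ValiantsHypothesis.ValiantsHypothesis.Theorems.KPlusLogSqLaw

namespace StaticTridiagonalRealOverlap

open Polynomial
open Summit.ValiantsHypothesis.ValiantsHypothesis.Theorems.KPlusLogSqLaw.StaticTridiagonalRealPotential
  (pathDet pathDet_two X_mul_derivative_monomial eval_ne_zero_of_eval_add_two_eq_zero)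

variable (a : ℕ → ℝ) (d : ℕ → ℕ) (b : ℕ → ℝ) (f : ℕ → ℕ)

/-! ### §1 The two Schur denominators and the Euler identity for a quotient of a monomial by a binomial -/

/-- `a₂x^{d₂}·D₂(x)` is the two-term polynomial `Q_L = a₂a₁a₀X^{d₂+(d₁+d₀)} − a₂b₀²X^{d₂+2f₀}` evaluated. -/
theorem eval_schurDen_left (z : ℝ) :
    (C (a 2 * (a 1 * a 0)) * (X : ℝ[X]) ^ (d 2 + (d 1 + d 0)) + C (a 2 * -(b 0 ^ 2)) * X ^ (d 2 + 2 * f 0)).eval z =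
      a 2 * z ^ d 2 * (pathDet a d b f 2).eval z := by
  rw [eval_pathDet_two']; simp only [eval_add, eval_mul, eval_C, eval_pow, eval_X, pow_add]; ring

/-- `a₂x^{d₂}·Δ(x)` is the two-term polynomial `Q_R = a₂a₄a₃X^{d₂+(d₄+d₃)} − a₂b₃²X^{d₂+2f₃}` evaluated. -/
theorem eval_schurDen_right (z : ℝ) :
    (C (a 2 * (a 4 * a 3)) * (X : ℝ[X]) ^ (d 2 + (d 4 + d 3)) + C (a 2 * -(b 3 ^ 2)) * X ^ (d 2 + 2 * f 3)).eval z =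
      a 2 * z ^ d 2 *
        (pathDet (fun t => a (t + 3)) (fun t => d (t + 3)) (fun t => b (t + 3)) (fun t => f (t + 3)) 2).eval z := by
  rw [eval_pathDet_shift_three_two]; simp only [eval_add, eval_mul, eval_C, eval_pow, eval_X, pow_add]; ring

/-- **Euler identity for a monomial over a binomial.**  For `P = c X^p`, `Q = α X^{q₁} + β X^{q₂}`:
`z · (P′(z) Q(z) − P(z) Q′(z)) = P(z) · ((p − q₁) α z^{q₁} + (p − q₂) β z^{q₂})`. [folklore] -/
theorem euler_monomial_div_binomial (c α β : ℝ) (p q₁ q₂ : ℕ) (z : ℝ) :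
    z * ((derivative (C c * (X : ℝ[X]) ^ p)).eval z * (C α * (X : ℝ[X]) ^ q₁ + C β * X ^ q₂).eval z -
        (C c * (X : ℝ[X]) ^ p).eval z * (derivative (C α * (X : ℝ[X]) ^ q₁ + C β * X ^ q₂)).eval z) =
      (C c * (X : ℝ[X]) ^ p).eval z * (((p : ℝ) - q₁) * α * z ^ q₁ + ((p : ℝ) - q₂) * β * z ^ q₂) := by
  have hP := congrArg (fun R => Polynomial.eval z R) (X_mul_derivative_monomial c p)
  have hA := congrArg (fun R => Polynomial.eval z R) (X_mul_derivative_monomial α q₁)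
  have hB := congrArg (fun R => Polynomial.eval z R) (X_mul_derivative_monomial β q₂)
  simp only [eval_mul, eval_X, eval_C, eval_pow] at hP hA hB
  rw [derivative_add]
  simp only [eval_add, eval_mul, eval_C, eval_pow, eval_X]
  have e1 : z * ((derivative (C c * X ^ p)).eval z * (α * z ^ q₁ + β * z ^ q₂) -
      c * z ^ p * ((derivative (C α * X ^ q₁)).eval z + (derivative (C β * X ^ q₂)).eval z)) =
      (z * (derivative (C c * X ^ p)).eval z) * (α * z ^ q₁ + β * z ^ q₂) -
        c * z ^ p * (z * (derivative (C α * X ^ q₁)).eval z + z * (derivative (C β * X ^ q₂)).eval z) := by ring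
  rw [e1, hP, hA, hB]
  ring

/-! ### §2 The derivative of a Schur summand -/

/-- **Derivative of the left Schur summand** `φ = b₁²a₀x^{2f₁+d₀}/(a₂x^{d₂}D₂)` at a point `z > 0` with `D₂(z) ≠ 0`, in the form
`(P′Q − PQ′)/Q²` with the Euler identity `z·(P′Q − PQ′)(z) = P(z)·a₂·NL(z)`,
`NL(z) = (σ₂)·a₁a₀z^{d₂+(d₁+d₀)} + (σ₁ − σ₂)·b₀²z^{d₂+2f₀}` (rates as real differences of exponents). -/
theorem hasDerivAt_schur_left (ha : ∀ t, 0 < a t) {z : ℝ} (hz : 0 < z) (hD2 : (pathDet a d b f 2).eval z ≠ 0) :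
    ∃ φ' : ℝ, HasDerivAt (fun w : ℝ => (C (b 1 ^ 2 * a 0) * (X : ℝ[X]) ^ (2 * f 1 + d 0)).eval w /
        (C (a 2 * (a 1 * a 0)) * (X : ℝ[X]) ^ (d 2 + (d 1 + d 0)) + C (a 2 * -(b 0 ^ 2)) * X ^ (d 2 + 2 * f 0)).eval w) φ' z ∧
      z * (φ' * (a 2 * z ^ d 2 * (pathDet a d b f 2).eval z) ^ 2) =
        (b 1 ^ 2 * a 0 * z ^ (2 * f 1 + d 0)) * (a 2 *
          ((((2 * f 1 + d 0 : ℕ) : ℝ) - ((d 2 + (d 1 + d 0) : ℕ) : ℝ)) * (a 1 * a 0) * z ^ (d 2 + (d 1 + d 0)) +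
            (((2 * f 1 + d 0 : ℕ) : ℝ) - ((d 2 + 2 * f 0 : ℕ) : ℝ)) * (-(b 0 ^ 2)) * z ^ (d 2 + 2 * f 0))) := by
  set P : ℝ[X] := C (b 1 ^ 2 * a 0) * (X : ℝ[X]) ^ (2 * f 1 + d 0) with hP
  set Q : ℝ[X] := C (a 2 * (a 1 * a 0)) * (X : ℝ[X]) ^ (d 2 + (d 1 + d 0)) + C (a 2 * -(b 0 ^ 2)) * X ^ (d 2 + 2 * f 0) with hQ
  have hQz : Q.eval z = a 2 * z ^ d 2 * (pathDet a d b f 2).eval z := eval_schurDen_left a d b f z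
  have hQne : Q.eval z ≠ 0 := by
    rw [hQz]; exact mul_ne_zero (mul_ne_zero (ha 2).ne' (pow_ne_zero _ hz.ne')) hD2
  have hder := (P.hasDerivAt z).div (Q.hasDerivAt z) hQne
  refine ⟨_, hder, ?_⟩
  have euler := euler_monomial_div_binomial (b 1 ^ 2 * a 0) (a 2 * (a 1 * a 0)) (a 2 * -(b 0 ^ 2))
    (2 * f 1 + d 0) (d 2 + (d 1 + d 0)) (d 2 + 2 * f 0) z
  rw [← hQz, div_mul_cancel₀ _ (pow_ne_zero 2 hQne), hP, hQ, euler]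
  simp only [eval_mul, eval_C, eval_pow, eval_X]
  ring

/-- **Derivative of the right Schur summand** `ψ = b₂²a₄x^{2f₂+d₄}/(a₂x^{d₂}Δ)` at a point `z > 0` with `Δ(z) ≠ 0`, with the Euler identity
`z·(P′Q − PQ′)(z) = P(z)·a₂·NR(z)`, `NR(z) = (σ₃)·a₄a₃z^{d₂+(d₄+d₃)} + (σ₄ − σ₃)·b₃²z^{d₂+2f₃}`. -/
theorem hasDerivAt_schur_right (ha : ∀ t, 0 < a t) {z : ℝ} (hz : 0 < z)
    (hΔ : (pathDet (fun t => a (t + 3)) (fun t => d (t + 3)) (fun t => b (t + 3)) (fun t => f (t + 3)) 2).eval z ≠ 0) :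
    ∃ ψ' : ℝ, HasDerivAt (fun w : ℝ => (C (b 2 ^ 2 * a 4) * (X : ℝ[X]) ^ (2 * f 2 + d 4)).eval w /
        (C (a 2 * (a 4 * a 3)) * (X : ℝ[X]) ^ (d 2 + (d 4 + d 3)) + C (a 2 * -(b 3 ^ 2)) * X ^ (d 2 + 2 * f 3)).eval w) ψ' z ∧
      z * (ψ' * (a 2 * z ^ d 2 *
          (pathDet (fun t => a (t + 3)) (fun t => d (t + 3)) (fun t => b (t + 3)) (fun t => f (t + 3)) 2).eval z) ^ 2) =
        (b 2 ^ 2 * a 4 * z ^ (2 * f 2 + d 4)) * (a 2 *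
          ((((2 * f 2 + d 4 : ℕ) : ℝ) - ((d 2 + (d 4 + d 3) : ℕ) : ℝ)) * (a 4 * a 3) * z ^ (d 2 + (d 4 + d 3)) +
            (((2 * f 2 + d 4 : ℕ) : ℝ) - ((d 2 + 2 * f 3 : ℕ) : ℝ)) * (-(b 3 ^ 2)) * z ^ (d 2 + 2 * f 3))) := by
  set P : ℝ[X] := C (b 2 ^ 2 * a 4) * (X : ℝ[X]) ^ (2 * f 2 + d 4) with hP
  set Q : ℝ[X] := C (a 2 * (a 4 * a 3)) * (X : ℝ[X]) ^ (d 2 + (d 4 + d 3)) + C (a 2 * -(b 3 ^ 2)) * X ^ (d 2 + 2 * f 3) with hQ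
  have hQz : Q.eval z = a 2 * z ^ d 2 *
      (pathDet (fun t => a (t + 3)) (fun t => d (t + 3)) (fun t => b (t + 3)) (fun t => f (t + 3)) 2).eval z :=
    eval_schurDen_right a d b f z
  have hQne : Q.eval z ≠ 0 := by
    rw [hQz]; exact mul_ne_zero (mul_ne_zero (ha 2).ne' (pow_ne_zero _ hz.ne')) hΔ
  have hder := (P.hasDerivAt z).div (Q.hasDerivAt z) hQne
  refine ⟨_, hder, ?_⟩
  have euler := euler_monomial_div_binomial (b 2 ^ 2 * a 4) (a 2 * (a 4 * a 3)) (a 2 * -(b 3 ^ 2))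
    (2 * f 2 + d 4) (d 2 + (d 4 + d 3)) (d 2 + 2 * f 3) z
  rw [← hQz, div_mul_cancel₀ _ (pow_ne_zero 2 hQne), hP, hQ, euler]
  simp only [eval_mul, eval_C, eval_pow, eval_X]
  ring

/-! ### §3 The monotone-piece law -/

/-- **THE MONOTONE-PIECE LAW (increasing pieces).**  Let `0 < x < y` be two zeros of `D₅` of a definite irreducible design such that on the
closed interval `[x, y]` the two end `2 × 2` minors `D₂`, `Δ` do not vanish (no pole of the Schur form) and the two rate functions
`NL(z) = σ₂·a₁a₀z^{d₂+d₁+d₀} + (σ₁−σ₂)·b₀²z^{d₂+2f₀}`, `NR(z) = σ₃·a₄a₃z^{d₂+d₄+d₃} + (σ₄−σ₃)·b₃²z^{d₂+2f₃}` are POSITIVE.  This is impossible: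
the Schur form `φ + ψ` is strictly increasing on `[x, y]` and equals `1` at both zeros.  So such an interval carries at most ONE zero of `D₅`. -/
theorem five_monotone_piece (ha : ∀ t, 0 < a t) (hb : ∀ t, b t ≠ 0) {x y : ℝ} (hx : 0 < x) (hxy : x < y)
    (hrx : (pathDet a d b f 5).eval x = 0) (hry : (pathDet a d b f 5).eval y = 0)
    (hD2 : ∀ z ∈ Set.Icc x y, (pathDet a d b f 2).eval z ≠ 0)
    (hΔ : ∀ z ∈ Set.Icc x y,
      (pathDet (fun t => a (t + 3)) (fun t => d (t + 3)) (fun t => b (t + 3)) (fun t => f (t + 3)) 2).eval z ≠ 0)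
    (hNL : ∀ z ∈ Set.Icc x y, 0 <
      (((2 * f 1 + d 0 : ℕ) : ℝ) - ((d 2 + (d 1 + d 0) : ℕ) : ℝ)) * (a 1 * a 0) * z ^ (d 2 + (d 1 + d 0)) +
        (((2 * f 1 + d 0 : ℕ) : ℝ) - ((d 2 + 2 * f 0 : ℕ) : ℝ)) * (-(b 0 ^ 2)) * z ^ (d 2 + 2 * f 0))
    (hNR : ∀ z ∈ Set.Icc x y, 0 <
      (((2 * f 2 + d 4 : ℕ) : ℝ) - ((d 2 + (d 4 + d 3) : ℕ) : ℝ)) * (a 4 * a 3) * z ^ (d 2 + (d 4 + d 3)) +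
        (((2 * f 2 + d 4 : ℕ) : ℝ) - ((d 2 + 2 * f 3 : ℕ) : ℝ)) * (-(b 3 ^ 2)) * z ^ (d 2 + 2 * f 3)) : False := by
  have hy : 0 < y := hx.trans hxy
  -- the Schur form as a real function
  set g : ℝ → ℝ := fun w =>
    (C (b 1 ^ 2 * a 0) * (X : ℝ[X]) ^ (2 * f 1 + d 0)).eval w /
        (C (a 2 * (a 1 * a 0)) * (X : ℝ[X]) ^ (d 2 + (d 1 + d 0)) + C (a 2 * -(b 0 ^ 2)) * X ^ (d 2 + 2 * f 0)).eval w +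
      (C (b 2 ^ 2 * a 4) * (X : ℝ[X]) ^ (2 * f 2 + d 4)).eval w /
        (C (a 2 * (a 4 * a 3)) * (X : ℝ[X]) ^ (d 2 + (d 4 + d 3)) + C (a 2 * -(b 3 ^ 2)) * X ^ (d 2 + 2 * f 3)).eval w with hg
  -- value `1` at every zero of `D₅` off the poles
  have hval : ∀ z, 0 < z → (pathDet a d b f 5).eval z = 0 → (pathDet a d b f 2).eval z ≠ 0 →
      (pathDet (fun t => a (t + 3)) (fun t => d (t + 3)) (fun t => b (t + 3)) (fun t => f (t + 3)) 2).eval z ≠ 0 → g z = 1 := by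
    intro z hz hr h2 h3
    have hM : 0 < a 2 * z ^ d 2 := mul_pos (ha 2) (pow_pos hz _)
    have v := five_eval_vertex a d b f z
    rw [hr] at v
    simp only [hg, eval_schurDen_left, eval_schurDen_right, eval_mul, eval_C, eval_pow, eval_X]
    rw [div_add_div _ _ (mul_ne_zero hM.ne' h2) (mul_ne_zero hM.ne' h3), div_eq_one_iff_eq
      (mul_ne_zero (mul_ne_zero hM.ne' h2) (mul_ne_zero hM.ne' h3))]
    linear_combination (a 2 * z ^ d 2) * v
  -- derivative and its positivity on `[x, y]`
  have hderiv : ∀ z ∈ Set.Icc x y, ∃ g' : ℝ, HasDerivAt g g' z ∧ 0 < g' := by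
    intro z hz
    have hz0 : 0 < z := hx.trans_le hz.1
    obtain ⟨φ', hφ, eφ⟩ := hasDerivAt_schur_left a d b f ha hz0 (hD2 z hz)
    obtain ⟨ψ', hψ, eψ⟩ := hasDerivAt_schur_right a d b f ha hz0 (hΔ z hz)
    refine ⟨φ' + ψ', hφ.add hψ, ?_⟩
    have hM : 0 < a 2 * z ^ d 2 := mul_pos (ha 2) (pow_pos hz0 _)
    have hQ1 : 0 < (a 2 * z ^ d 2 * (pathDet a d b f 2).eval z) ^ 2 := by
      have := mul_ne_zero hM.ne' (hD2 z hz); positivity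
    have hQ2 : 0 < (a 2 * z ^ d 2 *
        (pathDet (fun t => a (t + 3)) (fun t => d (t + 3)) (fun t => b (t + 3)) (fun t => f (t + 3)) 2).eval z) ^ 2 := by
      have := mul_ne_zero hM.ne' (hΔ z hz); positivity
    have hP1 : 0 < b 1 ^ 2 * a 0 * z ^ (2 * f 1 + d 0) := by
      have := hb 1; have := ha 0; positivity
    have hP2 : 0 < b 2 ^ 2 * a 4 * z ^ (2 * f 2 + d 4) := by
      have := hb 2; have := ha 4; positivity
    -- `z · φ′ · Q₁² > 0` and `z · ψ′ · Q₂² > 0`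
    have h1 : 0 < z * (φ' * (a 2 * z ^ d 2 * (pathDet a d b f 2).eval z) ^ 2) := by
      rw [eφ]; exact mul_pos hP1 (mul_pos (ha 2) (hNL z hz))
    have h2 : 0 < z * (ψ' * (a 2 * z ^ d 2 *
        (pathDet (fun t => a (t + 3)) (fun t => d (t + 3)) (fun t => b (t + 3)) (fun t => f (t + 3)) 2).eval z) ^ 2) := by
      rw [eψ]; exact mul_pos hP2 (mul_pos (ha 2) (hNR z hz))
    have hφ' : 0 < φ' := by
      have := (mul_pos_iff_of_pos_left hz0).mp h1
      exact (mul_pos_iff_of_pos_right hQ1).mp this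
    have hψ' : 0 < ψ' := by
      have := (mul_pos_iff_of_pos_left hz0).mp h2
      exact (mul_pos_iff_of_pos_right hQ2).mp this
    linarith
  have hcont : ContinuousOn g (Set.Icc x y) := fun z hz => by
    obtain ⟨g', hg', _⟩ := hderiv z hz
    exact hg'.continuousAt.continuousWithinAt
  have hmono : StrictMonoOn g (Set.Icc x y) := by
    refine strictMonoOn_of_deriv_pos (convex_Icc x y) hcont fun z hz => ?_
    rw [interior_Icc] at hz
    obtain ⟨g', hg', hpos⟩ := hderiv z (Set.Ioo_subset_Icc_self hz)
    rwa [hg'.deriv]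
  have hlt := hmono (Set.left_mem_Icc.2 hxy.le) (Set.right_mem_Icc.2 hxy.le) hxy
  rw [hval x hx hrx (hD2 x (Set.left_mem_Icc.2 hxy.le)) (hΔ x (Set.left_mem_Icc.2 hxy.le)),
    hval y hy hry (hD2 y (Set.right_mem_Icc.2 hxy.le)) (hΔ y (Set.right_mem_Icc.2 hxy.le))] at hlt
  exact lt_irrefl _ hlt

/-- **THE MONOTONE-PIECE LAW (decreasing pieces)**: the same with `NL < 0` and `NR < 0` on `[x, y]` (the Schur form is strictly decreasing). -/
theorem five_antitone_piece (ha : ∀ t, 0 < a t) (hb : ∀ t, b t ≠ 0) {x y : ℝ} (hx : 0 < x) (hxy : x < y)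
    (hrx : (pathDet a d b f 5).eval x = 0) (hry : (pathDet a d b f 5).eval y = 0)
    (hD2 : ∀ z ∈ Set.Icc x y, (pathDet a d b f 2).eval z ≠ 0)
    (hΔ : ∀ z ∈ Set.Icc x y,
      (pathDet (fun t => a (t + 3)) (fun t => d (t + 3)) (fun t => b (t + 3)) (fun t => f (t + 3)) 2).eval z ≠ 0)
    (hNL : ∀ z ∈ Set.Icc x y,
      (((2 * f 1 + d 0 : ℕ) : ℝ) - ((d 2 + (d 1 + d 0) : ℕ) : ℝ)) * (a 1 * a 0) * z ^ (d 2 + (d 1 + d 0)) +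
        (((2 * f 1 + d 0 : ℕ) : ℝ) - ((d 2 + 2 * f 0 : ℕ) : ℝ)) * (-(b 0 ^ 2)) * z ^ (d 2 + 2 * f 0) < 0)
    (hNR : ∀ z ∈ Set.Icc x y,
      (((2 * f 2 + d 4 : ℕ) : ℝ) - ((d 2 + (d 4 + d 3) : ℕ) : ℝ)) * (a 4 * a 3) * z ^ (d 2 + (d 4 + d 3)) +
        (((2 * f 2 + d 4 : ℕ) : ℝ) - ((d 2 + 2 * f 3 : ℕ) : ℝ)) * (-(b 3 ^ 2)) * z ^ (d 2 + 2 * f 3) < 0) : False := by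
  have hy : 0 < y := hx.trans hxy
  set g : ℝ → ℝ := fun w =>
    (C (b 1 ^ 2 * a 0) * (X : ℝ[X]) ^ (2 * f 1 + d 0)).eval w /
        (C (a 2 * (a 1 * a 0)) * (X : ℝ[X]) ^ (d 2 + (d 1 + d 0)) + C (a 2 * -(b 0 ^ 2)) * X ^ (d 2 + 2 * f 0)).eval w +
      (C (b 2 ^ 2 * a 4) * (X : ℝ[X]) ^ (2 * f 2 + d 4)).eval w /
        (C (a 2 * (a 4 * a 3)) * (X : ℝ[X]) ^ (d 2 + (d 4 + d 3)) + C (a 2 * -(b 3 ^ 2)) * X ^ (d 2 + 2 * f 3)).eval w with hg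
  have hval : ∀ z, 0 < z → (pathDet a d b f 5).eval z = 0 → (pathDet a d b f 2).eval z ≠ 0 →
      (pathDet (fun t => a (t + 3)) (fun t => d (t + 3)) (fun t => b (t + 3)) (fun t => f (t + 3)) 2).eval z ≠ 0 → g z = 1 := by
    intro z hz hr h2 h3
    have hM : 0 < a 2 * z ^ d 2 := mul_pos (ha 2) (pow_pos hz _)
    have v := five_eval_vertex a d b f z
    rw [hr] at v
    simp only [hg, eval_schurDen_left, eval_schurDen_right, eval_mul, eval_C, eval_pow, eval_X]
    rw [div_add_div _ _ (mul_ne_zero hM.ne' h2) (mul_ne_zero hM.ne' h3), div_eq_one_iff_eq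
      (mul_ne_zero (mul_ne_zero hM.ne' h2) (mul_ne_zero hM.ne' h3))]
    linear_combination (a 2 * z ^ d 2) * v
  have hderiv : ∀ z ∈ Set.Icc x y, ∃ g' : ℝ, HasDerivAt g g' z ∧ g' < 0 := by
    intro z hz
    have hz0 : 0 < z := hx.trans_le hz.1
    obtain ⟨φ', hφ, eφ⟩ := hasDerivAt_schur_left a d b f ha hz0 (hD2 z hz)
    obtain ⟨ψ', hψ, eψ⟩ := hasDerivAt_schur_right a d b f ha hz0 (hΔ z hz)
    refine ⟨φ' + ψ', hφ.add hψ, ?_⟩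
    have hM : 0 < a 2 * z ^ d 2 := mul_pos (ha 2) (pow_pos hz0 _)
    have hQ1 : 0 < (a 2 * z ^ d 2 * (pathDet a d b f 2).eval z) ^ 2 := by
      have := mul_ne_zero hM.ne' (hD2 z hz); positivity
    have hQ2 : 0 < (a 2 * z ^ d 2 *
        (pathDet (fun t => a (t + 3)) (fun t => d (t + 3)) (fun t => b (t + 3)) (fun t => f (t + 3)) 2).eval z) ^ 2 := by
      have := mul_ne_zero hM.ne' (hΔ z hz); positivity
    have hP1 : 0 < b 1 ^ 2 * a 0 * z ^ (2 * f 1 + d 0) := by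
      have := hb 1; have := ha 0; positivity
    have hP2 : 0 < b 2 ^ 2 * a 4 * z ^ (2 * f 2 + d 4) := by
      have := hb 2; have := ha 4; positivity
    have h1 : z * (φ' * (a 2 * z ^ d 2 * (pathDet a d b f 2).eval z) ^ 2) < 0 := by
      rw [eφ]; exact mul_neg_of_pos_of_neg hP1 (mul_neg_of_pos_of_neg (ha 2) (hNL z hz))
    have h2 : z * (ψ' * (a 2 * z ^ d 2 *
        (pathDet (fun t => a (t + 3)) (fun t => d (t + 3)) (fun t => b (t + 3)) (fun t => f (t + 3)) 2).eval z) ^ 2) < 0 := by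
      rw [eψ]; exact mul_neg_of_pos_of_neg hP2 (mul_neg_of_pos_of_neg (ha 2) (hNR z hz))
    have hφ' : φ' < 0 := by
      by_contra hc; push Not at hc
      exact absurd h1 (not_lt.2 (mul_nonneg hz0.le (mul_nonneg hc hQ1.le)))
    have hψ' : ψ' < 0 := by
      by_contra hc; push Not at hc
      exact absurd h2 (not_lt.2 (mul_nonneg hz0.le (mul_nonneg hc hQ2.le)))
    linarith
  have hcont : ContinuousOn g (Set.Icc x y) := fun z hz => by
    obtain ⟨g', hg', _⟩ := hderiv z hz
    exact hg'.continuousAt.continuousWithinAt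
  have hanti : StrictAntiOn g (Set.Icc x y) := by
    refine strictAntiOn_of_deriv_neg (convex_Icc x y) hcont fun z hz => ?_
    rw [interior_Icc] at hz
    obtain ⟨g', hg', hneg⟩ := hderiv z (Set.Ioo_subset_Icc_self hz)
    rwa [hg'.deriv]
  have hlt := hanti (Set.left_mem_Icc.2 hxy.le) (Set.right_mem_Icc.2 hxy.le) hxy
  rw [hval x hx hrx (hD2 x (Set.left_mem_Icc.2 hxy.le)) (hΔ x (Set.left_mem_Icc.2 hxy.le)),
    hval y hy hry (hD2 y (Set.right_mem_Icc.2 hxy.le)) (hΔ y (Set.right_mem_Icc.2 hxy.le))] at hlt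
  exact lt_irrefl _ hlt

end StaticTridiagonalRealOverlap

end Summit.ValiantsHypothesis.ValiantsHypothesis.Theorems.KPlusLogSqLaw
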